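import Summits.Ventures.LatticeQCDFlow.Exactness.FlowSamplerSymmetrisationParityDecomposition
import Summits.Ventures.LatticeQCDFlow.Exactness.Phi4LatticeSymmetry
import Summits.Ventures.LatticeQCDFlow.Exactness.Phi4FlowSignMagnetisation
import HarnessLib

/-!
# Lattice φ⁴, flip-symmetrised flow `q̃ₛ(φ) = ½(q̃(φ) + q̃(−φ))`: for EVERY polynomial observable, `τ^{q̃ₛ}(f)·Var f = τ^{q̃ₛ}(g₊)·Var g₊ + τ^{q̃ₛ}(g₋)·Var g₋ ≤ τ^{q̃}(g₊)·Var g₊ + τ^{q̃}(g₋)·Var g₋` (`g = f − ⟨f⟩`, even / odd parts)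

HONEST FRAMING: exact (Metropolis-corrected) sampling algorithms for lattice gauge theory;
figures of merit are autocorrelation/cost numbers at stated couplings and volumes; no
continuum-physics claim.  (SCALAR calibration rung S0-A: not a gauge result.)

Venture `LatticeQCDFlow` (cell pub-lqcd), topic `Exactness`; FANOUT row 2 (`s0-phi4`, FLOW arm).  NEW
WORK of the cell: the lattice instance of `FlowSamplerSymmetrisationParityDecomposition` for the global
flip `φ ↦ −φ` of lattice φ⁴ (`n + 1` sites, `S = Σ φJφ + λΣφ⁴` even, ANY `λ > 0`, real `J`), ANY positive
normalised flow density `q̃` and its flip-symmetrisation `q̃ₛ`.  For `f ∈ PolyObs`, `g = f − ⟨f⟩`,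
`g₊(φ) = ½(g(φ) + g(−φ))`, `g₋(φ) = ½(g(φ) − g(−φ))`:

* **`phi4FlowSym_tauInt_parity_split`** — if `Var g₊, Var g₋ > 0` and the SYMMETRISED sampler's
  normalised series for `g₊` and `g₋` are summable, then the series of `f` is summable and
  `τ^{q̃ₛ}(f)·Var f = τ^{q̃ₛ}(g₊)·Var g₊ + τ^{q̃ₛ}(g₋)·Var g₋` (`Var f = Var g₊ + Var g₋`);
* **`phi4FlowSym_tauInt_le_parity_mix`** — if the RAW flow sampler's series for `g₊` and `g₋` are
  summable, then `τ^{q̃ₛ}(f)·Var f ≤ τ^{q̃}(g₊)·Var g₊ + τ^{q̃}(g₋)·Var g₋`: the symmetrised flow never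
  makes a polynomial observable slower than the variance-weighted mean of the raw flow's `τ_int` on its
  even and odd parts (gen-22's `Phi4FlowSymmetrisedParity` treated the pure-parity observables).

Nothing is cited as a fact.  NOT CLAIMED: `τ^{q̃ₛ}(f) ≤ τ^{q̃}(f)` for mixed-parity `f` (false in
general); any value for any network; cost.
-/

namespace Summit.Ventures.LatticeQCDFlow.Exactness

open Real MeasureTheory Filter Finset Topology
open Summit.Ventures.LatticeQCDFlow.Scoring

variable {n : ℕ}

/-- **Parity split of `τ_int` under the flip-symmetrised flow, for every `f ∈ PolyObs`.** -/
theorem phi4FlowSym_tauInt_parity_split {lam : ℝ} (hlam : 0 < lam)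
    (J : Fin (n + 1) → Fin (n + 1) → ℝ) {q : (Fin (n + 1) → ℝ) → ℝ} (hq0 : ∀ φ, 0 < q φ)
    (hqm : Measurable q) (hqi : Integrable q) (hq1 : ∫ φ, q φ = 1) {f : (Fin (n + 1) → ℝ) → ℝ}
    (hf : PolyObs f)
    (hPp : 0 < ∫ φ, (((f φ - gibbsExpect J lam f) + (f (-φ) - gibbsExpect J lam f)) / 2) ^ 2
      * gibbsWeight J lam φ)
    (hPm : 0 < ∫ φ, (((f φ - gibbsExpect J lam f) - (f (-φ) - gibbsExpect J lam f)) / 2) ^ 2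
      * gibbsWeight J lam φ)
    (hsp : Summable fun k => (∫ φ,
        (fun s => ((f s - gibbsExpect J lam f) + (f (-s) - gibbsExpect J lam f)) / 2) φ
        * ((imhOpPhi4 J lam (fun ψ => (q ψ + q (-ψ)) / 2))^[k + 1]
            (fun s => ((f s - gibbsExpect J lam f) + (f (-s) - gibbsExpect J lam f)) / 2)) φ
        * gibbsWeight J lam φ)
        / ∫ φ, (((f φ - gibbsExpect J lam f) + (f (-φ) - gibbsExpect J lam f)) / 2) ^ 2
          * gibbsWeight J lam φ)
    (hsm : Summable fun k => (∫ φ,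
        (fun s => ((f s - gibbsExpect J lam f) - (f (-s) - gibbsExpect J lam f)) / 2) φ
        * ((imhOpPhi4 J lam (fun ψ => (q ψ + q (-ψ)) / 2))^[k + 1]
            (fun s => ((f s - gibbsExpect J lam f) - (f (-s) - gibbsExpect J lam f)) / 2)) φ
        * gibbsWeight J lam φ)
        / ∫ φ, (((f φ - gibbsExpect J lam f) - (f (-φ) - gibbsExpect J lam f)) / 2) ^ 2
          * gibbsWeight J lam φ) :
    (∫ φ, (f φ - gibbsExpect J lam f) ^ 2 * gibbsWeight J lam φ
        = (∫ φ, (((f φ - gibbsExpect J lam f) + (f (-φ) - gibbsExpect J lam f)) / 2) ^ 2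
            * gibbsWeight J lam φ)
          + ∫ φ, (((f φ - gibbsExpect J lam f) - (f (-φ) - gibbsExpect J lam f)) / 2) ^ 2
            * gibbsWeight J lam φ) ∧
    (Summable fun k => (∫ φ, (f φ - gibbsExpect J lam f)
        * ((imhOpPhi4 J lam (fun ψ => (q ψ + q (-ψ)) / 2))^[k + 1]
            (fun ψ => f ψ - gibbsExpect J lam f)) φ * gibbsWeight J lam φ)
        / ∫ φ, (f φ - gibbsExpect J lam f) ^ 2 * gibbsWeight J lam φ) ∧
    tauInt (fun k => (∫ φ, (f φ - gibbsExpect J lam f)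
        * ((imhOpPhi4 J lam (fun ψ => (q ψ + q (-ψ)) / 2))^[k]
            (fun ψ => f ψ - gibbsExpect J lam f)) φ * gibbsWeight J lam φ)
        / ∫ φ, (f φ - gibbsExpect J lam f) ^ 2 * gibbsWeight J lam φ)
        * (∫ φ, (f φ - gibbsExpect J lam f) ^ 2 * gibbsWeight J lam φ)
      = tauInt (fun k => (∫ φ,
            (fun s => ((f s - gibbsExpect J lam f) + (f (-s) - gibbsExpect J lam f)) / 2) φ
            * ((imhOpPhi4 J lam (fun ψ => (q ψ + q (-ψ)) / 2))^[k]
                (fun s => ((f s - gibbsExpect J lam f) + (f (-s) - gibbsExpect J lam f)) / 2)) φ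
            * gibbsWeight J lam φ)
            / ∫ φ, (((f φ - gibbsExpect J lam f) + (f (-φ) - gibbsExpect J lam f)) / 2) ^ 2
              * gibbsWeight J lam φ)
          * (∫ φ, (((f φ - gibbsExpect J lam f) + (f (-φ) - gibbsExpect J lam f)) / 2) ^ 2
              * gibbsWeight J lam φ)
        + tauInt (fun k => (∫ φ,
            (fun s => ((f s - gibbsExpect J lam f) - (f (-s) - gibbsExpect J lam f)) / 2) φ
            * ((imhOpPhi4 J lam (fun ψ => (q ψ + q (-ψ)) / 2))^[k]
                (fun s => ((f s - gibbsExpect J lam f) - (f (-s) - gibbsExpect J lam f)) / 2)) φ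
            * gibbsWeight J lam φ)
            / ∫ φ, (((f φ - gibbsExpect J lam f) - (f (-φ) - gibbsExpect J lam f)) / 2) ^ 2
              * gibbsWeight J lam φ)
          * (∫ φ, (((f φ - gibbsExpect J lam f) - (f (-φ) - gibbsExpect J lam f)) / 2) ^ 2
              * gibbsWeight J lam φ) := by
  obtain ⟨hgm, hg2⟩ := polyObs_sq_integrable hlam J (polyObs_sub_const hf (gibbsExpect J lam f))
  obtain ⟨hs0, hsmeas, hsi, hs1, hssym⟩ := symmetrised_facts (μ := volume)
    (σ := fun ψ : Fin (n + 1) → ℝ => -ψ) measurePreserving_neg_pi (fun φ => neg_neg φ) hq0 hqm hqi hq1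
  simp only [imhOpPhi4_eq_imhOp] at hsp hsm ⊢
  exact tauInt_parity_split (μ := volume) (σ := fun ψ : Fin (n + 1) → ℝ => -ψ)
    measurePreserving_neg_pi (fun φ => neg_neg φ) (fun φ => gibbsWeight_pos J lam φ)
    (continuous_gibbsWeight J lam).measurable (integrable_gibbsWeight hlam J)
    (fun φ => gibbsWeight_neg J lam φ) hs0 hsmeas hsi hs1 hssym hgm hg2 hPp hPm hsp hsm

/-- **THE FLIP-SYMMETRISED FLOW NEVER MAKES A POLYNOMIAL OBSERVABLE SLOWER THAN THE VARIANCE-WEIGHTED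
MEAN OF THE RAW FLOW'S `τ_int` ON ITS EVEN AND ODD PARTS.** -/
theorem phi4FlowSym_tauInt_le_parity_mix {lam : ℝ} (hlam : 0 < lam)
    (J : Fin (n + 1) → Fin (n + 1) → ℝ) {q : (Fin (n + 1) → ℝ) → ℝ} (hq0 : ∀ φ, 0 < q φ)
    (hqm : Measurable q) (hqi : Integrable q) (hq1 : ∫ φ, q φ = 1) {f : (Fin (n + 1) → ℝ) → ℝ}
    (hf : PolyObs f)
    (hPp : 0 < ∫ φ, (((f φ - gibbsExpect J lam f) + (f (-φ) - gibbsExpect J lam f)) / 2) ^ 2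
      * gibbsWeight J lam φ)
    (hPm : 0 < ∫ φ, (((f φ - gibbsExpect J lam f) - (f (-φ) - gibbsExpect J lam f)) / 2) ^ 2
      * gibbsWeight J lam φ)
    (hsp : Summable fun k => (∫ φ,
        (fun s => ((f s - gibbsExpect J lam f) + (f (-s) - gibbsExpect J lam f)) / 2) φ
        * ((imhOpPhi4 J lam q)^[k + 1]
            (fun s => ((f s - gibbsExpect J lam f) + (f (-s) - gibbsExpect J lam f)) / 2)) φ
        * gibbsWeight J lam φ)
        / ∫ φ, (((f φ - gibbsExpect J lam f) + (f (-φ) - gibbsExpect J lam f)) / 2) ^ 2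
          * gibbsWeight J lam φ)
    (hsm : Summable fun k => (∫ φ,
        (fun s => ((f s - gibbsExpect J lam f) - (f (-s) - gibbsExpect J lam f)) / 2) φ
        * ((imhOpPhi4 J lam q)^[k + 1]
            (fun s => ((f s - gibbsExpect J lam f) - (f (-s) - gibbsExpect J lam f)) / 2)) φ
        * gibbsWeight J lam φ)
        / ∫ φ, (((f φ - gibbsExpect J lam f) - (f (-φ) - gibbsExpect J lam f)) / 2) ^ 2
          * gibbsWeight J lam φ) :
    (Summable fun k => (∫ φ, (f φ - gibbsExpect J lam f)
        * ((imhOpPhi4 J lam (fun ψ => (q ψ + q (-ψ)) / 2))^[k + 1]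
            (fun ψ => f ψ - gibbsExpect J lam f)) φ * gibbsWeight J lam φ)
        / ∫ φ, (f φ - gibbsExpect J lam f) ^ 2 * gibbsWeight J lam φ) ∧
    tauInt (fun k => (∫ φ, (f φ - gibbsExpect J lam f)
        * ((imhOpPhi4 J lam (fun ψ => (q ψ + q (-ψ)) / 2))^[k]
            (fun ψ => f ψ - gibbsExpect J lam f)) φ * gibbsWeight J lam φ)
        / ∫ φ, (f φ - gibbsExpect J lam f) ^ 2 * gibbsWeight J lam φ)
        * (∫ φ, (f φ - gibbsExpect J lam f) ^ 2 * gibbsWeight J lam φ)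
      ≤ tauInt (fun k => (∫ φ,
            (fun s => ((f s - gibbsExpect J lam f) + (f (-s) - gibbsExpect J lam f)) / 2) φ
            * ((imhOpPhi4 J lam q)^[k]
                (fun s => ((f s - gibbsExpect J lam f) + (f (-s) - gibbsExpect J lam f)) / 2)) φ
            * gibbsWeight J lam φ)
            / ∫ φ, (((f φ - gibbsExpect J lam f) + (f (-φ) - gibbsExpect J lam f)) / 2) ^ 2
              * gibbsWeight J lam φ)
          * (∫ φ, (((f φ - gibbsExpect J lam f) + (f (-φ) - gibbsExpect J lam f)) / 2) ^ 2
              * gibbsWeight J lam φ)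
        + tauInt (fun k => (∫ φ,
            (fun s => ((f s - gibbsExpect J lam f) - (f (-s) - gibbsExpect J lam f)) / 2) φ
            * ((imhOpPhi4 J lam q)^[k]
                (fun s => ((f s - gibbsExpect J lam f) - (f (-s) - gibbsExpect J lam f)) / 2)) φ
            * gibbsWeight J lam φ)
            / ∫ φ, (((f φ - gibbsExpect J lam f) - (f (-φ) - gibbsExpect J lam f)) / 2) ^ 2
              * gibbsWeight J lam φ)
          * (∫ φ, (((f φ - gibbsExpect J lam f) - (f (-φ) - gibbsExpect J lam f)) / 2) ^ 2
              * gibbsWeight J lam φ) := by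
  obtain ⟨hgm, hg2⟩ := polyObs_sq_integrable hlam J (polyObs_sub_const hf (gibbsExpect J lam f))
  simp only [imhOpPhi4_eq_imhOp] at hsp hsm ⊢
  exact symmetrised_tauInt_le_parity_mix (μ := volume) (σ := fun ψ : Fin (n + 1) → ℝ => -ψ)
    measurePreserving_neg_pi (fun φ => neg_neg φ) (fun φ => gibbsWeight_pos J lam φ)
    (continuous_gibbsWeight J lam).measurable (integrable_gibbsWeight hlam J)
    (fun φ => gibbsWeight_neg J lam φ) hq0 hqm hqi hq1 hgm hg2 hPp hPm hsp hsm

end Summit.Ventures.LatticeQCDFlow.Exactness
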